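import Literature.MathematicalPhysics.QuantumFieldTheory.Balaban1983to89.Beta.SquareTable

/-!
# `Balaban1983to89.Beta.SquareTableSlots` — THE SLOT-FAMILIES SCALAR WALL: the realised one-loop leg table fed by ONE KERNEL PER
LEG PER SLOT (and per label, and per signed copy), instead of one kernel for all twelve legs

(β sub-cell of pub-balaban, row BETA-an3 gen 9, node BETA-an3-g9-SLOTFAMILIES; table-side companion of `SquareTable` §§10–15 for the
(D1) representation binder of BETA/WALL.md §6 / RULING (R16-2): «what the wall assumes of the one-loop physics is exactly `hident_avg` at
`μC j k := β⁰_j`».)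

HONEST FRAMING (mandatory, page 1).  «discharging `BetaPertH` makes Bałaban's UV stability UNCONDITIONAL — a real
constructive-QFT result; it is NOT the continuum limit and NOT the Clay problem.»  Gloss 1 (the LEAD's, BETA-SPEC §0):
«unconditional» means the coupling-window HYPOTHESIS of [Balaban1989LargeFieldII] (B16) p. 355's one displayed END STATEMENT is
discharged INSIDE THE LATTICE RENORMALIZATION PROGRAMME; every other input remains a verbatim QUOTATION of Bałaban's printed
theorems — the result is «B16's theorem with one hypothesis fewer», not a first-principles formalisation of B5–B16.  Gloss 2: the
object is the `EventualForm`-unconditional END statement, NOT «Theorem 2 as printed».  Gloss 3″ (v1.9r §7.20 (c), binding): the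
interval hypothesis of [Balaban1987RG1] Thm 2 p. 259 is REPLACED by the (R10-1′) carrier of PARTIAL SUMS; what is made
unconditional is an END STATEMENT under the explicit γ-smallness restrictions of the kernel binders — never «Theorem 2 as printed»,
never the continuum limit / mass gap / Clay.  NOTHING in this module is summit progress: it is [folklore] algebra and bookkeeping over
the tree's definitions and asserts nothing about Bałaban's propagators.

ABSOLUTE RULE (cell charter, verbatim in substance).  No internally-minted statement enters as a cited fact: every hypothesis of every
theorem below is kernel-proved in this package or an explicit binder of the theorem; NOTHING is cited.  The manuscripts under audit
(B5, B12, B16) appear ONLY as CONTEXT — to say which printed object motivates the generalisation; a printed β-coefficient from a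
different scheme is citable only together with a proved transfer statement, and no printed coefficient is used here at all.

WHY THIS MODULE (context, asserted nowhere below).  `SquareTable` §§10–15 (`oneLoopDrift_of_scalarBounds`, `_avg`;
`SquareTableAvgFirst` for the average-first variant) plug the realised background-field table `(univ, bfCoeff N, bfP, bfQ)` into the
lead's `ComposedRoad` sockets with the ACTUAL legs `F′_i = stP_i G_{n,b}`, `G′_i = stQ_i G_{n,b}`: all twelve legs of all six products are
difference stencils of ONE scalar kernel `G_{n,b} : ℤ⁴ → ℝ` (per scale `n`, per base point `b`).  The one-shot small-field propagator of
the manuscripts is NOT of that shape: at `U = 1` it is `𝒢 = ⊕_μ Γ_μ + U*·𝓛̂·U` ([Balaban1984PropagatorsI] (1.83) p. 31, typed in the tree as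
`Beta.VectorPropagatorDict.calG_eq_gammaSum_add_longitudinal`) — block-diagonal in the direction index but with a DIFFERENT scalar kernel
`Γ_μ` per direction (the `Γ_μ` are lattice-rotated copies of one another, none cubic-symmetric by itself, since the averaging `Q` smears the
`μ`-component along `μ`), and the background-field one-loop structure pairs DIFFERENT kernels inside one product: the spin×spin bubble of the
`(μ,ν)` polarization component carries one `Γ_μ`-line and one `Γ_ν`-line (`SpinTable` §1: the direction trace keeps `(β,β′) = (ν,μ)`), the
vector-Laplacian copies carry `Γ_c` for each of the four components `c`, and the ghost-shape slots carry the kernel of the gauge-fixing /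
constraint determinants.  With the one-kernel socket, whoever discharges the representation binder `hU` would have to bound the
cross-kernel deviations `Σ_w w_μw_ν·(table at Γ_α·(Γ_β − Γ_α))` — uniformly `O(1)` in the scale, but that bound IS the graded window
adapter's job.  This module moves it INTO the kernel-proved wall: every leg of every slot gets its own kernel.

WHAT IS DERIVED ([folklore] throughout; no cited facts).
* §1 NAMED ROWS.  The six graded scalar rows of `SquareTable` §§10/13 as two predicates on a kernel `G : ℤ⁴ → ℝ` at scale `n`:
  `WindowRows μ ν D n G` (`h0/h1/h2`: `|G − gFree| ≤ D₀/n²`, unit forward differences of `G − gFree` `≤ D₁/n³`, the mixed `(μ,ν)` second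
  difference `≤ D₂/n⁴`, on the whole lattice) and `DecayRows μ ν A δ n G` (`d0/d1/d2`: `A_je^{−(δ/n)‖v‖∞}‖v‖∞^{−2−j}` off the origin);
  monotone in the constants (`WindowRows.mono`, `DecayRows.mono`), so families with different constants meet common ones.
* §2 THE COPY-ENLARGED REALISED TABLE.  For a finite copy type `K` and SIGNED copy weights `ω : BfIdx → K → ℝ` with `Σ_κ ω_{iκ} = 1` for
  every slot `i`, the table over `BfIdx × K` with coefficients `bfCoeff N i·ω_{iκ}` and the realised legs `bfP i`, `bfQ i` (`cpCoeff`, `cpP`,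
  `cpQ`) has degree `6` (`hdeg_cp`), the SAME continuum bubble as the realised table (`contBubble_cp`) and hence `hval` with Bałaban's
  normalised constant `kappaBal N` exactly (`hval_cp`, by `SquareTable.hval_bf`).  Signed weights are what the sector bookkeeping needs:
  the two `cellForm`-shaped slots carry the NET of four vector copies at loop weight `−½` and one ghost at `+1` (`SpinTable.three_sectors`,
  a MODEL computation, context only),
  i.e. relative copy weights `(½,½,½,½,−1)` summing to `1`; nonnegativity is required only of the base-point weights `wt`.
* §3 THE SLOT-FAMILIES STENCIL KERNEL `stKc μ ν N ω GP GQ (w) = w_μw_ν·Σ_{(i,κ)} bfCoeff N i·ω_{iκ}·stP_i(GP (i,κ))(w)·stQ_i(GQ (i,κ))(w)`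
  — one kernel `GP (i,κ)` for the first leg and one `GQ (i,κ)` for the second leg of every enlarged slot; at a CONSTANT family and trivial
  copies it is `SquareTable.stK` (`stKc_const`); its shellwise decay from slot-wise leg tails (`abs_stKc_le_of_legTails`,
  `WindowInterface.shellBound_of_legDecay`).
* §4 SLOT-WISE ADAPTERS.  The four leg binders of the `ComposedRoad` sockets for the legs `F′_{(i,κ)} = stP_i(GP_{n[,b]}(i,κ))`,
  `G′_{(i,κ)} = stQ_i(GQ_{n[,b]}(i,κ))` from `WindowRows`/`DecayRows` of every slot kernel with slot-free (and base-point-free) constants —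
  each is `SquareTable.hF_of_graded(_avg)` / `hG_…` / `hFtail_of_decay(_avg)` / `hGtail_…` applied BY NAME to the family of ONE slot and read at
  that slot.
* §5 IDENTIFICATION.  The `hident` binders from ONE full-sum comparison per scale against `fullSum (stKc …)` (resp. its `wt`-convex combination
  over base points), the window truncation costing only `ε` (`SquareTable.hident_of_fullSum_graded(_avg)` by name).
* §6 THE WALLS.  **`oneLoopDrift_of_slotBounds`** / **`oneLoopDrift_of_slotBounds_avg`** and the END statements
  **`endpointExistence_of_slotBounds`** / **`endpointExistence_of_slotBounds_avg`**: `SquareTable.oneLoopDrift_of_scalarBounds(_avg)` /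
  `endpointExistence_of_scalarBounds(_avg)` with the single kernel family replaced by the slot families `GP`, `GQ` (the six rows required of
  EVERY slot kernel, constants free of slot, copy and base point) and the comparison kernel `stK` replaced by `stKc`; conclusion
  `OneLoopDrift (stepBal N Lc) (constA …) cc (kappaBal N·transverseValue) S.β0` with the constant of the one-kernel wall in which the slot sums
  run over `BfIdx × K` with `|bfCoeff N i·ω_{iκ}|`.
* §7 CONSISTENCY.  At trivial copies (`K = Unit`, `ω = 1`) and the constant family `GP = GQ = G_{n,b}` the hypotheses are those of
  `SquareTable.oneLoopDrift_of_scalarBounds_avg` and so is the conclusion (the closing `example` of §7, which re-derives that landed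
  theorem verbatim from `oneLoopDrift_of_slotBounds_avg` via `stKc_const`, `bubbleConst_cp_unit`, `sumTail_cp_unit`, `sumWindow_cp_unit`):
  nothing is lost.
* §8 PRODUCT LABELS.  Convex base-point weights times convex copy weights are convex weights on the product label set
  (`convexWeights_product`): NONNEGATIVE copy splittings may equally be folded into the labels of the one-kernel-per-slot socket.

WHAT IS NOT TOUCHED (located, by name; other rows' work): the representation itself — that the composed marginal coefficient's leg-product
part IS `Σ_b wt_b·fullSum (stKc …)` for Bałaban's slot kernels ((D1): lead / an2 (N1-B), `MinimiserIdentityForm`, `KernelSpecInstance`);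
the slot kernels' six rows ((D3): an1 `VectorTails*`, an4 `WallVolumeTransfer` / `EntrywiseVolumeLimit`, an5); products of stencils at
MIRRORED or SHIFTED corners (`F_νΓ(w)·F_μΓ′(w+e_ν)`, re-based summation variables) — these are further table SHAPES, not further kernels,
and belong to a stencil-menu enlargement of the table (successor menu; `SquareTable` §§7–8 already give the free legs at shifted corners);
the average-first (cross-base-point) twin of this module (`SquareTableAvgFirst` with slot families; successor menu); every `k ≥ 1` object.

Sources (CONTEXT only; nothing of them is used).  [Balaban1984PropagatorsI] (Comm. Math. Phys. 95 (1984) 17–40) p. 31 (1.83), via the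
tree dictionary `Beta.VectorPropagatorDict` (header: pages read as images there); [Balaban1987RG1] (INDEX B12) p. 264 (1.20)–(1.22) (the
moment whose shape `hval` serves); [Balaban1989LargeFieldII] (INDEX B16) p. 355 (the END statement, via `FlowStep`).
Tags: [folklore] = elementary algebra / bookkeeping proved here, or a definition asserting nothing.  No `axiom`, no `sorry`.
v1 (2026-08-19, unit `b2b-balaban-beta-an3-g9`); imports `…Beta.SquareTable` only.
-/

noncomputable section

namespace Literature.MathematicalPhysics.QuantumFieldTheory.Balaban1983to89.Beta.SquareTableSlots

open Finset
open scoped BigOperators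
open Literature.Probability.LatticeModels (annulus)
open Literature.MathematicalPhysics.QuantumFieldTheory.Balaban1983to89
open Literature.MathematicalPhysics.QuantumFieldTheory.Balaban1983to89.Beta
open Literature.MathematicalPhysics.QuantumFieldTheory.Balaban1983to89.Beta.BubbleTransfer
open Literature.MathematicalPhysics.QuantumFieldTheory.Balaban1983to89.Beta.TwoPowerLegs
open Literature.MathematicalPhysics.QuantumFieldTheory.Balaban1983to89.Beta.TransverseStructure
open Literature.MathematicalPhysics.QuantumFieldTheory.Balaban1983to89.Beta.TransverseLink
open Literature.MathematicalPhysics.QuantumFieldTheory.Balaban1983to89.Beta.LeadingCoefficient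
open Literature.MathematicalPhysics.QuantumFieldTheory.Balaban1983to89.Beta.GhostTable
open Literature.MathematicalPhysics.QuantumFieldTheory.Balaban1983to89.Beta.DyadicShell (Pt toReal supNorm)
open Literature.MathematicalPhysics.QuantumFieldTheory.Balaban1983to89.Beta.SquareTable

/-! ## §1 The six graded scalar rows as named predicates -/

section Rows

variable {μ ν : Fin 4}

/-- **THE THREE WINDOW ROWS** of a kernel `G : ℤ⁴ → ℝ` at scale `n` against `gFree` (`SquareTable` §10's `h0/h1/h2` for one kernel at one
scale): value `D₀/n²`, unit forward differences `D₁/n³`, mixed `(μ,ν)` second difference `D₂/n⁴`, on the whole lattice. [folklore] -/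
structure WindowRows (μ ν : Fin 4) (D : ℕ → ℝ) (n : ℕ) (G : Pt → ℝ) : Prop where
  h0 : ∀ v, |G v - gFree v| ≤ D 0 / (n : ℝ) ^ 2
  h1 : ∀ v (ρ : Fin 4), |(G (v + unitVec ρ) - gFree (v + unitVec ρ)) - (G v - gFree v)| ≤ D 1 / (n : ℝ) ^ 3
  h2 : ∀ v, |(G (v + unitVec ν + unitVec μ) - gFree (v + unitVec ν + unitVec μ)) - (G (v + unitVec ν) - gFree (v + unitVec ν)) -
      (G (v + unitVec μ) - gFree (v + unitVec μ)) + (G v - gFree v)| ≤ D 2 / (n : ℝ) ^ 4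

/-- **THE THREE DECAY ROWS** of a kernel `G : ℤ⁴ → ℝ` at scale `n` off the origin (`SquareTable` §13's `d0/d1/d2` for one kernel at one
scale): `A_je^{−(δ/n)‖v‖∞}‖v‖∞^{−2−j}`, `j = 0, 1, 2`. [folklore] -/
structure DecayRows (μ ν : Fin 4) (A : ℕ → ℝ) (δ : ℝ) (n : ℕ) (G : Pt → ℝ) : Prop where
  d0 : ∀ v : Pt, v ≠ 0 → |G v| ≤ A 0 * Real.exp (-(δ / n) * supNorm v) / (supNorm v : ℝ) ^ 2
  d1 : ∀ v : Pt, v ≠ 0 → ∀ ρ : Fin 4, |G (v + unitVec ρ) - G v| ≤ A 1 * Real.exp (-(δ / n) * supNorm v) / (supNorm v : ℝ) ^ 3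
  d2 : ∀ v : Pt, v ≠ 0 → |G (v + unitVec ν + unitVec μ) - G (v + unitVec ν) - G (v + unitVec μ) + G v| ≤
      A 2 * Real.exp (-(δ / n) * supNorm v) / (supNorm v : ℝ) ^ 4

/-- window rows are monotone in the constants. [folklore] -/
theorem WindowRows.mono {D D' : ℕ → ℝ} {n : ℕ} {G : Pt → ℝ} (h : WindowRows μ ν D n G) (hDD : ∀ j, D j ≤ D' j) :
    WindowRows μ ν D' n G where
  h0 v := (h.h0 v).trans (div_le_div_of_nonneg_right (hDD 0) (by positivity))
  h1 v ρ := (h.h1 v ρ).trans (div_le_div_of_nonneg_right (hDD 1) (by positivity))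
  h2 v := (h.h2 v).trans (div_le_div_of_nonneg_right (hDD 2) (by positivity))

/-- decay rows are monotone in the constants and antitone in the rate. [folklore] -/
theorem DecayRows.mono {A A' : ℕ → ℝ} {δ δ' : ℝ} {n : ℕ} {G : Pt → ℝ} (h : DecayRows μ ν A δ n G) (hA : ∀ j, 0 ≤ A j)
    (hAA : ∀ j, A j ≤ A' j) (hδ : δ' ≤ δ) : DecayRows μ ν A' δ' n G := by
  have key : ∀ (j k : ℕ) (v : Pt), A j * Real.exp (-(δ / n) * supNorm v) / (supNorm v : ℝ) ^ k ≤
      A' j * Real.exp (-(δ' / n) * supNorm v) / (supNorm v : ℝ) ^ k := by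
    intro j k v
    apply div_le_div_of_nonneg_right _ (by positivity)
    apply mul_le_mul (hAA j) _ (Real.exp_nonneg _) ((hA j).trans (hAA j))
    apply Real.exp_le_exp.mpr
    have hs : (0 : ℝ) ≤ (supNorm v : ℝ) := by positivity
    have hn : (0 : ℝ) ≤ (n : ℝ) := by positivity
    rcases hn.eq_or_lt with hn0 | hn0
    · rw [← hn0]; simp
    · have : δ' / n ≤ δ / n := div_le_div_of_nonneg_right hδ hn0.le
      nlinarith
  exact ⟨fun v hv => (h.d0 v hv).trans (key 0 2 v), fun v hv ρ => (h.d1 v hv ρ).trans (key 1 3 v),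
    fun v hv => (h.d2 v hv).trans (key 2 4 v)⟩

/-- packaging: the three verbatim window rows of `SquareTable` for a scale-indexed family give `WindowRows` at every scale. [folklore] -/
theorem WindowRows.of_rows {Gf : ℕ → Pt → ℝ} {D : ℕ → ℝ}
    (h0 : ∀ n : ℕ, 2 ≤ n → ∀ v, |Gf n v - gFree v| ≤ D 0 / (n : ℝ) ^ 2)
    (h1 : ∀ n : ℕ, 2 ≤ n → ∀ v (ρ : Fin 4),
      |(Gf n (v + unitVec ρ) - gFree (v + unitVec ρ)) - (Gf n v - gFree v)| ≤ D 1 / (n : ℝ) ^ 3)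
    (h2 : ∀ n : ℕ, 2 ≤ n → ∀ v,
      |(Gf n (v + unitVec ν + unitVec μ) - gFree (v + unitVec ν + unitVec μ)) - (Gf n (v + unitVec ν) - gFree (v + unitVec ν)) -
          (Gf n (v + unitVec μ) - gFree (v + unitVec μ)) + (Gf n v - gFree v)| ≤ D 2 / (n : ℝ) ^ 4) :
    ∀ n : ℕ, 2 ≤ n → WindowRows μ ν D n (Gf n) :=
  fun n hn => ⟨h0 n hn, h1 n hn, h2 n hn⟩

/-- packaging: the three verbatim decay rows of `SquareTable` for a scale-indexed family give `DecayRows` at every scale. [folklore] -/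
theorem DecayRows.of_rows {Gf : ℕ → Pt → ℝ} {A : ℕ → ℝ} {δ : ℝ}
    (d0 : ∀ n : ℕ, 2 ≤ n → ∀ v : Pt, v ≠ 0 → |Gf n v| ≤ A 0 * Real.exp (-(δ / n) * supNorm v) / (supNorm v : ℝ) ^ 2)
    (d1 : ∀ n : ℕ, 2 ≤ n → ∀ v : Pt, v ≠ 0 → ∀ ρ : Fin 4,
      |Gf n (v + unitVec ρ) - Gf n v| ≤ A 1 * Real.exp (-(δ / n) * supNorm v) / (supNorm v : ℝ) ^ 3)
    (d2 : ∀ n : ℕ, 2 ≤ n → ∀ v : Pt, v ≠ 0 →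
      |Gf n (v + unitVec ν + unitVec μ) - Gf n (v + unitVec ν) - Gf n (v + unitVec μ) + Gf n v| ≤
        A 2 * Real.exp (-(δ / n) * supNorm v) / (supNorm v : ℝ) ^ 4) :
    ∀ n : ℕ, 2 ≤ n → DecayRows μ ν A δ n (Gf n) :=
  fun n hn => ⟨d0 n hn, d1 n hn, d2 n hn⟩

end Rows

/-! ## §2 The copy-enlarged realised table: signed copy weights, same continuum bubble, same `hval` -/

section CopyTable

variable {μ ν : Fin 4} {K : Type*}

/-- coefficients of the copy-enlarged table: `bfCoeff N i·ω_{iκ}` on the slot `(i,κ)`. [folklore] -/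
def cpCoeff (N : ℝ) (ω : BfIdx → K → ℝ) : BfIdx × K → ℝ := fun p => bfCoeff N p.1 * ω p.1 p.2

/-- first table legs of the copy-enlarged table: the realised ones, copied. [folklore] -/
def cpP (hμν : μ ≠ ν) : BfIdx × K → Leg := fun p => bfP hμν p.1

/-- second table legs of the copy-enlarged table: the realised ones, copied. [folklore] -/
def cpQ (hμν : μ ≠ ν) : BfIdx × K → Leg := fun p => bfQ hμν p.1

/-- unfolding. [folklore] -/
@[simp] theorem cpCoeff_apply (N : ℝ) (ω : BfIdx → K → ℝ) (p : BfIdx × K) : cpCoeff N ω p = bfCoeff N p.1 * ω p.1 p.2 := rfl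
/-- unfolding. [folklore] -/
@[simp] theorem cpP_apply (hμν : μ ≠ ν) (p : BfIdx × K) : cpP (K := K) hμν p = bfP hμν p.1 := rfl
/-- unfolding. [folklore] -/
@[simp] theorem cpQ_apply (hμν : μ ≠ ν) (p : BfIdx × K) : cpQ (K := K) hμν p = bfQ hμν p.1 := rfl

variable [Fintype K]

/-- degree bookkeeping of the copy-enlarged table: `6` throughout. [folklore] -/
theorem hdeg_cp (hμν : μ ≠ ν) : ∀ p ∈ (Finset.univ : Finset (BfIdx × K)), (cpP hμν p).a + (cpQ hμν p).a = 6 :=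
  fun p _ => hdeg_bf hμν p.1 (Finset.mem_univ _)

/-- **THE COPIES CONTRIBUTE EXACTLY THE REALISED CONTINUUM BUBBLE** when the copy weights of every slot sum to `1` (signed weights
allowed). [folklore] -/
theorem contBubble_cp (hμν : μ ≠ ν) (N : ℝ) {ω : BfIdx → K → ℝ} (hω : ∀ i, ∑ κ, ω i κ = 1) (x : E4) :
    contBubble Finset.univ (cpCoeff N ω) (cpP hμν) (cpQ hμν) x = contBubble Finset.univ (bfCoeff N) (bfP hμν) (bfQ hμν) x := by
  simp only [contBubble, cpCoeff_apply, cpP_apply, cpQ_apply]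
  rw [← Finset.univ_product_univ, Finset.sum_product]
  refine Finset.sum_congr rfl fun i _ => ?_
  have : ∑ κ : K, bfCoeff N i * ω i κ * ((bfP hμν i).ℓ x * (bfQ hμν i).ℓ x) =
      (bfCoeff N i * ((bfP hμν i).ℓ x * (bfQ hμν i).ℓ x)) * ∑ κ : K, ω i κ := by
    rw [Finset.mul_sum]; exact Finset.sum_congr rfl fun κ _ => by ring
  rw [this, hω i, mul_one]

/-- **`hval` OF THE COPY-ENLARGED TABLE = `hval` OF THE REALISED TABLE**: Bałaban's normalised constant `kappaBal N` exactly
(`SquareTable.hval_bf`). [folklore] -/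
theorem hval_cp (hμν : μ ≠ ν) (N : ℝ) {ω : BfIdx → K → ℝ} (hω : ∀ i, ∑ κ, ω i κ = 1) :
    ∀ x : E4, x ≠ 0 → x μ * x ν * contBubble Finset.univ (cpCoeff N ω) (cpP hμν) (cpQ hμν) x = leadingIntegrand (kappaBal N) μ ν x :=
  fun x hx => by rw [contBubble_cp hμν N hω]; exact hval_bf hμν N x hx

/-- the trivial copy structure: one copy of weight `1`. [folklore] -/
def unitCopy : BfIdx → Unit → ℝ := fun _ _ => 1

/-- its weights sum to `1`. [folklore] -/
theorem unitCopy_sum (i : BfIdx) : ∑ κ, unitCopy i κ = 1 := by simp [unitCopy]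

/-- the transfer constant of the trivially-copied table is that of the realised table. [folklore] -/
theorem bubbleConst_cp_unit (hμν : μ ≠ ν) (N : ℝ) :
    bubbleConst Finset.univ (cpCoeff N unitCopy) (cpP hμν) (cpQ hμν) = bubbleConst Finset.univ (bfCoeff N) (bfP hμν) (bfQ hμν) := by
  simp only [bubbleConst, cpCoeff_apply, cpP_apply, cpQ_apply, unitCopy, mul_one]
  rw [← Finset.univ_product_univ, Finset.sum_product]
  simp

end CopyTable


/-! ## §3 The slot-families stencil kernel -/

section Kernel

variable {μ ν : Fin 4} {K : Type*} [Fintype K]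

open Literature.MathematicalPhysics.QuantumFieldTheory.Balaban1983to89.Beta.WindowInterface (shellBound_of_legDecay)

/-- **THE SLOT-FAMILIES STENCIL KERNEL**: the `(1.22)`-integrand of the copy-enlarged realised table with the first leg of the slot
`(i,κ)` the `i`-th first stencil of ITS OWN kernel `GP (i,κ)` and the second leg the `i`-th second stencil of ITS OWN kernel `GQ (i,κ)`:
`w_μw_ν·Σ_{(i,κ)} bfCoeff N i·ω_{iκ}·stP_i(GP (i,κ))(w)·stQ_i(GQ (i,κ))(w)`. [folklore] -/
def stKc (μ ν : Fin 4) (N : ℝ) (ω : BfIdx → K → ℝ) (GP GQ : BfIdx × K → Pt → ℝ) (w : Pt) : ℝ :=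
  toReal w μ * toReal w ν *
    ∑ p ∈ (Finset.univ : Finset (BfIdx × K)), cpCoeff N ω p * (stP μ ν (GP p) p.1 w * stQ μ ν (GQ p) p.1 w)

omit [Fintype K] in
/-- **AT ONE KERNEL FOR ALL LEGS AND ONE COPY THE SLOT KERNEL IS `SquareTable.stK`.** [folklore] -/
theorem stKc_const (N : ℝ) (G : Pt → ℝ) (w : Pt) :
    stKc μ ν N unitCopy (fun _ : BfIdx × Unit => G) (fun _ => G) w = stK μ ν N G w := by
  simp only [stKc, stK, cpCoeff_apply, unitCopy, mul_one]
  rw [← Finset.univ_product_univ, Finset.sum_product]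
  simp

/-- **SHELLWISE DECAY OF THE SLOT KERNEL FROM SLOT-WISE LEG TAILS** (total degree `6`, `WindowInterface.shellBound_of_legDecay`): on the
shell `‖w‖∞ = r+1`, `|stP_i(GP (i,κ))(w)| ≤ R′_{iκ}(r+1)^{−a_i}·ε` and `|stQ_i(GQ (i,κ))(w)| ≤ S′_{iκ}(r+1)^{−b_i}` give
`|stKc (w)| ≤ (Σ|bfCoeff N i·ω_{iκ}|R′S′)(r+1)⁻⁴·ε`. [folklore] -/
theorem abs_stKc_le_of_legTails (hμν : μ ≠ ν) {N : ℝ} {ω : BfIdx → K → ℝ} {GP GQ : BfIdx × K → Pt → ℝ}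
    {R' S' : BfIdx × K → ℝ} {ε : ℝ} (hε : 0 ≤ ε) (hR' : ∀ p ∈ (Finset.univ : Finset (BfIdx × K)), 0 ≤ R' p)
    {r : ℕ} {w : Pt} (hw : w ∈ annulus 4 r (r + 1))
    (hF : ∀ p ∈ (Finset.univ : Finset (BfIdx × K)), |stP μ ν (GP p) p.1 w| ≤ R' p / ((r : ℝ) + 1) ^ (bfP hμν p.1).a * ε)
    (hG : ∀ p ∈ (Finset.univ : Finset (BfIdx × K)), |stQ μ ν (GQ p) p.1 w| ≤ S' p / ((r : ℝ) + 1) ^ (bfQ hμν p.1).a) :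
    |stKc μ ν N ω GP GQ w| ≤ (∑ p ∈ (Finset.univ : Finset (BfIdx × K)), |cpCoeff N ω p| * (R' p * S' p)) / ((r : ℝ) + 1) ^ 4 * ε :=
  shellBound_of_legDecay (hdeg_cp hμν) μ ν hw hε hR' hF hG

end Kernel

/-! ## §4 Slot-wise window and tail adapters (one point; per base point) -/

section Adapters

variable {μ ν : Fin 4} {K : Type*} [Fintype K] {κB : Type*}

/-- **(W2′)₀ SLOT BY SLOT, first legs**: `WindowRows` of every first-leg kernel `GP_n (i,κ)` (`n ≥ 2`, constants free of the slot) give the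
`hF` binder for `F′_{(i,κ)} = stP_i(GP_n (i,κ))` along `n = Lc^m` — `SquareTable.hF_of_graded` for the family of ONE slot, read at that
slot. [folklore] -/
theorem hF_slots (hμν : μ ≠ ν) {Lc : ℕ} (hL : 2 ≤ Lc) {M : ℕ → ℕ} (hML : ∀ n : ℕ, 2 ≤ n → M n ≤ n)
    {GP : ℕ → BfIdx × K → Pt → ℝ} {D : ℕ → ℝ} (hD : ∀ j, 0 ≤ D j) (hW : ∀ n : ℕ, 2 ≤ n → ∀ p, WindowRows μ ν D n (GP n p)) :
    ∀ m : ℕ, 1 ≤ m → ∀ w ∈ annulus 4 0 (M (Lc ^ m)), ∀ p ∈ (Finset.univ : Finset (BfIdx × K)),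
      |stP μ ν (GP (Lc ^ m) p) p.1 w - (bfP hμν p.1).f (Lc ^ m) 0 w| ≤
        D ((bfP hμν p.1).a - 2) / ((supNorm w : ℝ) ^ ((bfP hμν p.1).a - 2) * ((Lc ^ m : ℕ) : ℝ) ^ 2) :=
  fun m hm w hw p _ =>
    hF_of_graded hμν hL hML (Gf := fun n => GP n p) hD (fun n hn => (hW n hn p).h0) (fun n hn => (hW n hn p).h1)
      (fun n hn => (hW n hn p).h2) m hm w hw p.1 (Finset.mem_univ _)

/-- **(W2′)₀ SLOT BY SLOT, second legs** (`G′_{(i,κ)} = stQ_i(GQ_n (i,κ))`; `SquareTable.hG_of_graded` per slot). [folklore] -/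
theorem hG_slots (hμν : μ ≠ ν) {Lc : ℕ} (hL : 2 ≤ Lc) {M : ℕ → ℕ} (hML : ∀ n : ℕ, 2 ≤ n → M n ≤ n)
    {GQ : ℕ → BfIdx × K → Pt → ℝ} {D : ℕ → ℝ} (hD : ∀ j, 0 ≤ D j) (hW : ∀ n : ℕ, 2 ≤ n → ∀ p, WindowRows μ ν D n (GQ n p)) :
    ∀ m : ℕ, 1 ≤ m → ∀ w ∈ annulus 4 0 (M (Lc ^ m)), ∀ p ∈ (Finset.univ : Finset (BfIdx × K)),
      |stQ μ ν (GQ (Lc ^ m) p) p.1 w - (bfQ hμν p.1).f (Lc ^ m) 0 w| ≤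
        D ((bfQ hμν p.1).a - 2) / ((supNorm w : ℝ) ^ ((bfQ hμν p.1).a - 2) * ((Lc ^ m : ℕ) : ℝ) ^ 2) :=
  fun m hm w hw p _ =>
    hG_of_graded hμν hL hML (Gf := fun n => GQ n p) hD (fun n hn => (hW n hn p).h0) (fun n hn => (hW n hn p).h1)
      (fun n hn => (hW n hn p).h2) m hm w hw p.1 (Finset.mem_univ _)

/-- **(W3a)₀ SLOT BY SLOT, first legs**: `DecayRows` of every first-leg kernel give `hFtail` with `R′_{(i,κ)} = A_{a_i−2}`
(`SquareTable.hFtail_of_decay` per slot). [folklore] -/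
theorem hFtail_slots (hμν : μ ≠ ν) {Lc : ℕ} {GP : ℕ → BfIdx × K → Pt → ℝ} {A : ℕ → ℝ} {δ : ℝ} {M : ℕ → ℕ}
    (hDk : ∀ n : ℕ, 2 ≤ n → ∀ p, DecayRows μ ν A δ n (GP n p)) (hL : 2 ≤ Lc) :
    ∀ m : ℕ, 1 ≤ m → ∀ r : ℕ, M (Lc ^ m) ≤ r → ∀ w ∈ annulus 4 r (r + 1), ∀ p ∈ (Finset.univ : Finset (BfIdx × K)),
      |stP μ ν (GP (Lc ^ m) p) p.1 w| ≤ A ((bfP hμν p.1).a - 2) / ((r : ℝ) + 1) ^ (bfP hμν p.1).a *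
        Real.exp (-(δ / ((Lc ^ m : ℕ) : ℝ)) * ((r : ℝ) + 1)) :=
  fun m hm r hr w hw p _ =>
    hFtail_of_decay hμν (Gf := fun n => GP n p) (M := M) (fun n hn => (hDk n hn p).d0) (fun n hn => (hDk n hn p).d1)
      (fun n hn => (hDk n hn p).d2) hL m hm r hr w hw p.1 (Finset.mem_univ _)

/-- **(W3a)₀ SLOT BY SLOT, second legs**: `S′_{(i,κ)} = 2^{b_i}A_{b_i−2}` (`SquareTable.hGtail_of_decay` per slot; needs the window floor
`M ≥ 1`). [folklore] -/
theorem hGtail_slots (hμν : μ ≠ ν) {Lc : ℕ} {GQ : ℕ → BfIdx × K → Pt → ℝ} {A : ℕ → ℝ} {δ : ℝ} {M : ℕ → ℕ} (hA : ∀ j, 0 ≤ A j)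
    (hδ : 0 < δ) (hM1 : ∀ L : ℕ, 2 ≤ L → 1 ≤ M L) (hDk : ∀ n : ℕ, 2 ≤ n → ∀ p, DecayRows μ ν A δ n (GQ n p)) (hL : 2 ≤ Lc) :
    ∀ m : ℕ, 1 ≤ m → ∀ r : ℕ, M (Lc ^ m) ≤ r → ∀ w ∈ annulus 4 r (r + 1), ∀ p ∈ (Finset.univ : Finset (BfIdx × K)),
      |stQ μ ν (GQ (Lc ^ m) p) p.1 w| ≤ A ((bfQ hμν p.1).a - 2) * 2 ^ (bfQ hμν p.1).a / ((r : ℝ) + 1) ^ (bfQ hμν p.1).a :=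
  fun m hm r hr w hw p _ =>
    hGtail_of_decay hμν (Gf := fun n => GQ n p) hA hδ hM1 (fun n hn => (hDk n hn p).d0) (fun n hn => (hDk n hn p).d1)
      (fun n hn => (hDk n hn p).d2) hL m hm r hr w hw p.1 (Finset.mem_univ _)

/-- **(W2′)₀ SLOT BY SLOT AND PER BASE POINT, first legs** (`SquareTable.hF_of_graded_avg` per slot). [folklore] -/
theorem hF_slots_avg (hμν : μ ≠ ν) {Lc : ℕ} (hL : 2 ≤ Lc) {M : ℕ → ℕ} (hML : ∀ n : ℕ, 2 ≤ n → M n ≤ n)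
    {Bset : ℕ → Finset κB} {GP : ℕ → κB → BfIdx × K → Pt → ℝ} {D : ℕ → ℝ} (hD : ∀ j, 0 ≤ D j)
    (hW : ∀ n : ℕ, 2 ≤ n → ∀ b ∈ Bset n, ∀ p, WindowRows μ ν D n (GP n b p)) :
    ∀ m : ℕ, 1 ≤ m → ∀ b ∈ Bset (Lc ^ m), ∀ w ∈ annulus 4 0 (M (Lc ^ m)), ∀ p ∈ (Finset.univ : Finset (BfIdx × K)),
      |stP μ ν (GP (Lc ^ m) b p) p.1 w - (bfP hμν p.1).f (Lc ^ m) 0 w| ≤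
        D ((bfP hμν p.1).a - 2) / ((supNorm w : ℝ) ^ ((bfP hμν p.1).a - 2) * ((Lc ^ m : ℕ) : ℝ) ^ 2) :=
  fun m hm b hb w hw p _ =>
    hF_of_graded_avg hμν hL hML (Gf := fun n b => GP n b p) hD (fun n hn b hb => (hW n hn b hb p).h0)
      (fun n hn b hb => (hW n hn b hb p).h1) (fun n hn b hb => (hW n hn b hb p).h2) m hm b hb w hw p.1 (Finset.mem_univ _)

/-- **(W2′)₀ SLOT BY SLOT AND PER BASE POINT, second legs** (`SquareTable.hG_of_graded_avg` per slot). [folklore] -/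
theorem hG_slots_avg (hμν : μ ≠ ν) {Lc : ℕ} (hL : 2 ≤ Lc) {M : ℕ → ℕ} (hML : ∀ n : ℕ, 2 ≤ n → M n ≤ n)
    {Bset : ℕ → Finset κB} {GQ : ℕ → κB → BfIdx × K → Pt → ℝ} {D : ℕ → ℝ} (hD : ∀ j, 0 ≤ D j)
    (hW : ∀ n : ℕ, 2 ≤ n → ∀ b ∈ Bset n, ∀ p, WindowRows μ ν D n (GQ n b p)) :
    ∀ m : ℕ, 1 ≤ m → ∀ b ∈ Bset (Lc ^ m), ∀ w ∈ annulus 4 0 (M (Lc ^ m)), ∀ p ∈ (Finset.univ : Finset (BfIdx × K)),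
      |stQ μ ν (GQ (Lc ^ m) b p) p.1 w - (bfQ hμν p.1).f (Lc ^ m) 0 w| ≤
        D ((bfQ hμν p.1).a - 2) / ((supNorm w : ℝ) ^ ((bfQ hμν p.1).a - 2) * ((Lc ^ m : ℕ) : ℝ) ^ 2) :=
  fun m hm b hb w hw p _ =>
    hG_of_graded_avg hμν hL hML (Gf := fun n b => GQ n b p) hD (fun n hn b hb => (hW n hn b hb p).h0)
      (fun n hn b hb => (hW n hn b hb p).h1) (fun n hn b hb => (hW n hn b hb p).h2) m hm b hb w hw p.1 (Finset.mem_univ _)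

/-- **(W3a)₀ SLOT BY SLOT AND PER BASE POINT, first legs** (`SquareTable.hFtail_of_decay_avg` per slot). [folklore] -/
theorem hFtail_slots_avg (hμν : μ ≠ ν) {Lc : ℕ} {Bset : ℕ → Finset κB} {GP : ℕ → κB → BfIdx × K → Pt → ℝ} {A : ℕ → ℝ} {δ : ℝ}
    {M : ℕ → ℕ} (hA : ∀ j, 0 ≤ A j) (hDk : ∀ n : ℕ, 2 ≤ n → ∀ b ∈ Bset n, ∀ p, DecayRows μ ν A δ n (GP n b p)) (hL : 2 ≤ Lc) :
    ∀ m : ℕ, 1 ≤ m → ∀ b ∈ Bset (Lc ^ m), ∀ r : ℕ, M (Lc ^ m) ≤ r → ∀ w ∈ annulus 4 r (r + 1),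
      ∀ p ∈ (Finset.univ : Finset (BfIdx × K)),
      |stP μ ν (GP (Lc ^ m) b p) p.1 w| ≤ A ((bfP hμν p.1).a - 2) / ((r : ℝ) + 1) ^ (bfP hμν p.1).a *
        Real.exp (-(δ / ((Lc ^ m : ℕ) : ℝ)) * ((r : ℝ) + 1)) :=
  fun m hm b hb r hr w hw p _ =>
    hFtail_of_decay_avg hμν (Gf := fun n b => GP n b p) (M := M) hA (fun n hn b hb => (hDk n hn b hb p).d0)
      (fun n hn b hb => (hDk n hn b hb p).d1) (fun n hn b hb => (hDk n hn b hb p).d2) hL m hm b hb r hr w hw p.1 (Finset.mem_univ _)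

/-- **(W3a)₀ SLOT BY SLOT AND PER BASE POINT, second legs** (`SquareTable.hGtail_of_decay_avg` per slot). [folklore] -/
theorem hGtail_slots_avg (hμν : μ ≠ ν) {Lc : ℕ} {Bset : ℕ → Finset κB} {GQ : ℕ → κB → BfIdx × K → Pt → ℝ} {A : ℕ → ℝ} {δ : ℝ}
    {M : ℕ → ℕ} (hA : ∀ j, 0 ≤ A j) (hδ : 0 < δ) (hM1 : ∀ L : ℕ, 2 ≤ L → 1 ≤ M L)
    (hDk : ∀ n : ℕ, 2 ≤ n → ∀ b ∈ Bset n, ∀ p, DecayRows μ ν A δ n (GQ n b p)) (hL : 2 ≤ Lc) :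
    ∀ m : ℕ, 1 ≤ m → ∀ b ∈ Bset (Lc ^ m), ∀ r : ℕ, M (Lc ^ m) ≤ r → ∀ w ∈ annulus 4 r (r + 1),
      ∀ p ∈ (Finset.univ : Finset (BfIdx × K)),
      |stQ μ ν (GQ (Lc ^ m) b p) p.1 w| ≤ A ((bfQ hμν p.1).a - 2) * 2 ^ (bfQ hμν p.1).a / ((r : ℝ) + 1) ^ (bfQ hμν p.1).a :=
  fun m hm b hb r hr w hw p _ =>
    hGtail_of_decay_avg hμν (Gf := fun n b => GQ n b p) hA hδ hM1 (fun n hn b hb => (hDk n hn b hb p).d0)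
      (fun n hn b hb => (hDk n hn b hb p).d1) (fun n hn b hb => (hDk n hn b hb p).d2) hL m hm b hb r hr w hw p.1 (Finset.mem_univ _)

end Adapters

/-! ## §5 The identification binders from one full-sum comparison per scale -/

section Identification

variable {μ ν : Fin 4} {K : Type*} [Fintype K] {κB : Type*}

open Literature.MathematicalPhysics.QuantumFieldTheory.Balaban1983to89.Beta.MarginalTelescoping (composedCoeff)
open Literature.MathematicalPhysics.QuantumFieldTheory.Balaban1983to89.Beta.WindowIdentification (fullSum)

/-- **`hident` FOR THE SLOT LEGS FROM (W3b′)ₛₗ AND THE SLOT TAILS** (one point): the slot-wise tails give the shellwise decay of `stKc`,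
so `|composedCoeff μC m − fullSum (stKc …_{Lc^m})| ≤ U` truncates to the window at cost `ε` (`SquareTable.hident_of_fullSum_graded`).
[folklore] -/
theorem hident_of_slotFullSum (hμν : μ ≠ ν) {N : ℝ} {Lc : ℕ} (hL : 2 ≤ Lc) {μC : ℕ → ℕ → ℝ} {ω : BfIdx → K → ℝ}
    {GP GQ : ℕ → BfIdx × K → Pt → ℝ} {R' S' : BfIdx × K → ℝ} {δ U : ℝ} {M : ℕ → ℕ}
    (hR' : ∀ p ∈ (Finset.univ : Finset (BfIdx × K)), 0 ≤ R' p) (hS' : ∀ p ∈ (Finset.univ : Finset (BfIdx × K)), 0 ≤ S' p)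
    (hδ : 0 < δ)
    (hFtail : ∀ m : ℕ, 1 ≤ m → ∀ r : ℕ, M (Lc ^ m) ≤ r → ∀ w ∈ annulus 4 r (r + 1), ∀ p ∈ (Finset.univ : Finset (BfIdx × K)),
      |stP μ ν (GP (Lc ^ m) p) p.1 w| ≤ R' p / ((r : ℝ) + 1) ^ (bfP hμν p.1).a * Real.exp (-(δ / ((Lc ^ m : ℕ) : ℝ)) * ((r : ℝ) + 1)))
    (hGtail : ∀ m : ℕ, 1 ≤ m → ∀ r : ℕ, M (Lc ^ m) ≤ r → ∀ w ∈ annulus 4 r (r + 1), ∀ p ∈ (Finset.univ : Finset (BfIdx × K)),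
      |stQ μ ν (GQ (Lc ^ m) p) p.1 w| ≤ S' p / ((r : ℝ) + 1) ^ (bfQ hμν p.1).a)
    (hU : ∀ m : ℕ, 1 ≤ m → |composedCoeff μC m - fullSum (stKc μ ν N ω (GP (Lc ^ m)) (GQ (Lc ^ m)))| ≤ U) {ε : ℝ} (hε : 0 < ε) :
    ∀ m : ℕ, 1 ≤ m → ∃ R₀ : ℕ, M (Lc ^ m) ≤ R₀ ∧
      |composedCoeff μC m - ∑ w ∈ annulus 4 0 R₀, toReal w μ * toReal w ν *
        ∑ p ∈ (Finset.univ : Finset (BfIdx × K)), cpCoeff N ω p * (stP μ ν (GP (Lc ^ m) p) p.1 w * stQ μ ν (GQ (Lc ^ m) p) p.1 w)| ≤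
          U + ε := by
  have hE : 0 ≤ ∑ p ∈ (Finset.univ : Finset (BfIdx × K)), |cpCoeff N ω p| * (R' p * S' p) :=
    Finset.sum_nonneg fun p hp => mul_nonneg (abs_nonneg _) (mul_nonneg (hR' p hp) (hS' p hp))
  have htail : ∀ m : ℕ, 1 ≤ m → ∀ r : ℕ, M (Lc ^ m) ≤ r → ∀ w ∈ annulus 4 r (r + 1),
      |stKc μ ν N ω (GP (Lc ^ m)) (GQ (Lc ^ m)) w| ≤
        (∑ p ∈ (Finset.univ : Finset (BfIdx × K)), |cpCoeff N ω p| * (R' p * S' p)) / ((r : ℝ) + 1) ^ 4 *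
          Real.exp (-(δ / ((Lc ^ m : ℕ) : ℝ)) * ((r : ℝ) + 1)) :=
    fun m hm r hr w hw =>
      abs_stKc_le_of_legTails hμν (Real.exp_nonneg _) hR' hw (hFtail m hm r hr w hw) (hGtail m hm r hr w hw)
  exact hident_of_fullSum_graded (K := fun m => stKc μ ν N ω (GP (Lc ^ m)) (GQ (Lc ^ m))) (by omega) hE hδ htail hU hε

/-- **`hident` FOR THE SLOT LEGS, PER BASE POINT, FROM (W3b′)ₛₗ-avg** (`SquareTable.hident_of_fullSum_graded_avg`: the slot tails are
`b`-free, so the truncation is uniform in `b`). [folklore] -/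
theorem hident_of_slotFullSum_avg (hμν : μ ≠ ν) {N : ℝ} {Lc : ℕ} (hL : 2 ≤ Lc) {μC : ℕ → ℕ → ℝ} {ω : BfIdx → K → ℝ}
    {Bset : ℕ → Finset κB} {wt : ℕ → κB → ℝ} {GP GQ : ℕ → κB → BfIdx × K → Pt → ℝ} {R' S' : BfIdx × K → ℝ} {δ U : ℝ} {M : ℕ → ℕ}
    (hwt0 : ∀ n : ℕ, 2 ≤ n → ∀ b ∈ Bset n, 0 ≤ wt n b) (hwt1 : ∀ n : ℕ, 2 ≤ n → ∑ b ∈ Bset n, wt n b = 1)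
    (hR' : ∀ p ∈ (Finset.univ : Finset (BfIdx × K)), 0 ≤ R' p) (hS' : ∀ p ∈ (Finset.univ : Finset (BfIdx × K)), 0 ≤ S' p)
    (hδ : 0 < δ)
    (hFtail : ∀ m : ℕ, 1 ≤ m → ∀ b ∈ Bset (Lc ^ m), ∀ r : ℕ, M (Lc ^ m) ≤ r → ∀ w ∈ annulus 4 r (r + 1),
      ∀ p ∈ (Finset.univ : Finset (BfIdx × K)),
      |stP μ ν (GP (Lc ^ m) b p) p.1 w| ≤ R' p / ((r : ℝ) + 1) ^ (bfP hμν p.1).a * Real.exp (-(δ / ((Lc ^ m : ℕ) : ℝ)) * ((r : ℝ) + 1)))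
    (hGtail : ∀ m : ℕ, 1 ≤ m → ∀ b ∈ Bset (Lc ^ m), ∀ r : ℕ, M (Lc ^ m) ≤ r → ∀ w ∈ annulus 4 r (r + 1),
      ∀ p ∈ (Finset.univ : Finset (BfIdx × K)), |stQ μ ν (GQ (Lc ^ m) b p) p.1 w| ≤ S' p / ((r : ℝ) + 1) ^ (bfQ hμν p.1).a)
    (hU : ∀ m : ℕ, 1 ≤ m →
      |composedCoeff μC m - ∑ b ∈ Bset (Lc ^ m), wt (Lc ^ m) b * fullSum (stKc μ ν N ω (GP (Lc ^ m) b) (GQ (Lc ^ m) b))| ≤ U)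
    {ε : ℝ} (hε : 0 < ε) :
    ∀ m : ℕ, 1 ≤ m → ∃ R₀ : ℕ, M (Lc ^ m) ≤ R₀ ∧
      |composedCoeff μC m - ∑ b ∈ Bset (Lc ^ m), wt (Lc ^ m) b * ∑ w ∈ annulus 4 0 R₀, toReal w μ * toReal w ν *
        ∑ p ∈ (Finset.univ : Finset (BfIdx × K)), cpCoeff N ω p *
          (stP μ ν (GP (Lc ^ m) b p) p.1 w * stQ μ ν (GQ (Lc ^ m) b p) p.1 w)| ≤ U + ε := by
  have hE : 0 ≤ ∑ p ∈ (Finset.univ : Finset (BfIdx × K)), |cpCoeff N ω p| * (R' p * S' p) :=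
    Finset.sum_nonneg fun p hp => mul_nonneg (abs_nonneg _) (mul_nonneg (hR' p hp) (hS' p hp))
  have hpow : ∀ m : ℕ, 1 ≤ m → 2 ≤ Lc ^ m := fun m hm => hL.trans (Nat.le_self_pow (by omega) Lc)
  have htail : ∀ m : ℕ, 1 ≤ m → ∀ b ∈ Bset (Lc ^ m), ∀ r : ℕ, M (Lc ^ m) ≤ r → ∀ w ∈ annulus 4 r (r + 1),
      |stKc μ ν N ω (GP (Lc ^ m) b) (GQ (Lc ^ m) b) w| ≤
        (∑ p ∈ (Finset.univ : Finset (BfIdx × K)), |cpCoeff N ω p| * (R' p * S' p)) / ((r : ℝ) + 1) ^ 4 *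
          Real.exp (-(δ / ((Lc ^ m : ℕ) : ℝ)) * ((r : ℝ) + 1)) :=
    fun m hm b hb r hr w hw =>
      abs_stKc_le_of_legTails hμν (Real.exp_nonneg _) hR' hw (hFtail m hm b hb r hr w hw) (hGtail m hm b hb r hr w hw)
  exact hident_of_fullSum_graded_avg (K := fun m b => stKc μ ν N ω (GP (Lc ^ m) b) (GQ (Lc ^ m) b)) (by omega) hE hδ
    (fun m hm => hwt0 _ (hpow m hm)) (fun m hm => hwt1 _ (hpow m hm)) htail hU hε

end Identification

/-! ## §6 The slot-families walls and their end statements -/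

section Walls

variable {μ ν : Fin 4} {K : Type*} [Fintype K] {κB : Type*}

open FlowStep DagBinding
open Literature.MathematicalPhysics.QuantumFieldTheory.Balaban1983to89.Beta.LargeLWindow.WindowDecomposition (constA)
open Literature.MathematicalPhysics.QuantumFieldTheory.Balaban1983to89.Beta.Drift (OneLoopDrift)
open Literature.MathematicalPhysics.QuantumFieldTheory.Balaban1983to89.Beta.MarginalTelescoping (composedCoeff IdentityForm)
open Literature.MathematicalPhysics.QuantumFieldTheory.Balaban1983to89.Beta.RemainderChain (RemainderConst)
open Literature.MathematicalPhysics.QuantumFieldTheory.Balaban1983to89.Beta.DriftRemainder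
  (endpointExistence_of_drift_remainderConst)
open Literature.MathematicalPhysics.QuantumFieldTheory.Balaban1983to89.Beta.WindowIdentification (fullSum)
open Literature.MathematicalPhysics.QuantumFieldTheory.Balaban1983to89.Beta.ComposedRoad
  (oneLoopDrift_of_composedLegInterfacePow_identity oneLoopDrift_of_composedLegInterfacePow_identity_avg)

/-- **THE SLOT-FAMILIES SCALAR WALL (one point).**  `SquareTable.oneLoopDrift_of_scalarBounds` with the single kernel family replaced by
ONE KERNEL PER LEG PER SLOT of the copy-enlarged realised table: first-leg kernels `GP_n (i,κ)`, second-leg kernels `GQ_n (i,κ)`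
(`(i,κ) ∈ BfIdx × K`, signed copy weights `ω` with `Σ_κ ω_{iκ} = 1`), EACH obeying the six graded rows (`WindowRows` against `gFree`,
`DecayRows` off the origin) with constants free of the slot; window data; ONE comparison per scale of `composedCoeff μC m` with
`fullSum (stKc …_{Lc^m})` ((W3b′)ₛₗ); `IdentityForm`.  Conclusion: `OneLoopDrift` at Bałaban's `kappaBal N·transverseValue` with the
one-kernel wall's constant in which the slot sums run over `BfIdx × K`.  Nothing about Bałaban's propagators is asserted. [folklore] -/
theorem oneLoopDrift_of_slotBounds {β : HBeta} (S : B12Beta.OneLoopSplit β) (hμν : μ ≠ ν) {N : ℝ} (hN : N ≠ 0)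
    {Lc : ℕ} (hL : 2 ≤ Lc) {μC : ℕ → ℕ → ℝ} {ω : BfIdx → K → ℝ} (hω : ∀ i, ∑ κ, ω i κ = 1)
    {GP GQ : ℕ → BfIdx × K → Pt → ℝ} {D A : ℕ → ℝ} (hD : ∀ j, 0 ≤ D j) (hA : ∀ j, 0 ≤ A j)
    {δ U cc : ℝ} {M : ℕ → ℕ} (hδ : 0 < δ)
    (hc : 1 ≤ cc) (hM : ∀ L : ℕ, 2 ≤ L → 1 ≤ M L ∧ (L : ℝ) ≤ cc * M L) (hML : ∀ L : ℕ, 2 ≤ L → M L ≤ L)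
    (hWP : ∀ n : ℕ, 2 ≤ n → ∀ p, WindowRows μ ν D n (GP n p)) (hWQ : ∀ n : ℕ, 2 ≤ n → ∀ p, WindowRows μ ν D n (GQ n p))
    (hDP : ∀ n : ℕ, 2 ≤ n → ∀ p, DecayRows μ ν A δ n (GP n p)) (hDQ : ∀ n : ℕ, 2 ≤ n → ∀ p, DecayRows μ ν A δ n (GQ n p))
    (hU : ∀ m : ℕ, 1 ≤ m → |composedCoeff μC m - fullSum (stKc μ ν N ω (GP (Lc ^ m)) (GQ (Lc ^ m)))| ≤ U)
    (hid : IdentityForm μC S.β0) :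
    OneLoopDrift (B12Normalization.stepBal N Lc)
      (constA (|kappaBal N| * 24 + |kappaBal N| * 110592) (bubbleConst Finset.univ (cpCoeff N ω) (cpP hμν) (cpQ hμν))
          ((80 * (∑ p ∈ (Finset.univ : Finset (BfIdx × K)), |cpCoeff N ω p| *
              (A ((bfP hμν p.1).a - 2) * (A ((bfQ hμν p.1).a - 2) * 2 ^ (bfQ hμν p.1).a))) * (1 + cc / δ) + (U + 1)) +
            80 * ∑ p ∈ (Finset.univ : Finset (BfIdx × K)), |cpCoeff N ω p| *
              ((((bfP hμν p.1).A + (bfP hμν p.1).B) * D ((bfQ hμν p.1).a - 2) +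
                  D ((bfP hμν p.1).a - 2) * ((bfQ hμν p.1).A + (bfQ hμν p.1).B) +
                D ((bfP hμν p.1).a - 2) * D ((bfQ hμν p.1).a - 2))))
          cc (kappaBal N * transverseValue)) S.β0 :=
  have hR' : ∀ p ∈ (Finset.univ : Finset (BfIdx × K)), 0 ≤ A ((bfP hμν p.1).a - 2) := fun p _ => hA _
  have hS' : ∀ p ∈ (Finset.univ : Finset (BfIdx × K)), 0 ≤ A ((bfQ hμν p.1).a - 2) * 2 ^ (bfQ hμν p.1).a :=
    fun p _ => mul_nonneg (hA _) (by positivity)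
  oneLoopDrift_of_composedLegInterfacePow_identity S (hdeg_cp hμν) hμν hN (hval_cp hμν N hω) hL
    (F' := fun p n w => stP μ ν (GP n p) p.1 w) (G' := fun p n w => stQ μ ν (GQ n p) p.1 w)
    (fun _ _ => hD _) (fun _ _ => hD _) hR' hS' hδ hc hM hML (hF_slots hμν hL hML hD hWP) (hG_slots hμν hL hML hD hWQ)
    (hFtail_slots hμν hDP hL) (hGtail_slots hμν hA hδ (fun L hL2 => (hM L hL2).1) hDQ hL)
    (hident_of_slotFullSum hμν hL hR' hS' hδ (hFtail_slots hμν hDP hL)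
      (hGtail_slots hμν hA hδ (fun L hL2 => (hM L hL2).1) hDQ hL) hU one_pos) hid

/-- **`EndpointExistence` FROM THE SLOT-FAMILIES WALL (one point)**: composition with
`DriftRemainder.endpointExistence_of_drift_remainderConst`; downstream binders verbatim (`RemainderConst`, `r ≤ stepBal`, `BetaContH`,
`BetaUpperH`, `ForwardGenerated`).  Conditional end statement; NOT the continuum limit, NOT Clay. [folklore] -/
theorem endpointExistence_of_slotBounds {β : HBeta} {Cn : B12.Construction} (hgen : ForwardGenerated Cn β)
    (S : B12Beta.OneLoopSplit β) (hμν : μ ≠ ν) {N : ℝ} (hN : N ≠ 0)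
    {Lc : ℕ} (hL : 2 ≤ Lc) {μC : ℕ → ℕ → ℝ} {ω : BfIdx → K → ℝ} (hω : ∀ i, ∑ κ, ω i κ = 1)
    {GP GQ : ℕ → BfIdx × K → Pt → ℝ} {D A : ℕ → ℝ} (hD : ∀ j, 0 ≤ D j) (hA : ∀ j, 0 ≤ A j)
    {δ U cc : ℝ} {M : ℕ → ℕ} (hδ : 0 < δ)
    (hc : 1 ≤ cc) (hM : ∀ L : ℕ, 2 ≤ L → 1 ≤ M L ∧ (L : ℝ) ≤ cc * M L) (hML : ∀ L : ℕ, 2 ≤ L → M L ≤ L)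
    (hWP : ∀ n : ℕ, 2 ≤ n → ∀ p, WindowRows μ ν D n (GP n p)) (hWQ : ∀ n : ℕ, 2 ≤ n → ∀ p, WindowRows μ ν D n (GQ n p))
    (hDP : ∀ n : ℕ, 2 ≤ n → ∀ p, DecayRows μ ν A δ n (GP n p)) (hDQ : ∀ n : ℕ, 2 ≤ n → ∀ p, DecayRows μ ν A δ n (GQ n p))
    (hU : ∀ m : ℕ, 1 ≤ m → |composedCoeff μC m - fullSum (stKc μ ν N ω (GP (Lc ^ m)) (GQ (Lc ^ m)))| ≤ U)
    (hid : IdentityForm μC S.β0)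
    {rr γ₀ β' : ℝ} (hγ₀ : 0 < γ₀) (hrem : RemainderConst S γ₀ rr) (hr : rr ≤ B12Normalization.stepBal N Lc)
    (hβ' : 0 ≤ β') (hcont : BetaContH γ₀ β) (hup : BetaUpperH β' γ₀ β) : EndpointExistence Cn :=
  endpointExistence_of_drift_remainderConst hgen S hγ₀
    (oneLoopDrift_of_slotBounds S hμν hN hL hω hD hA hδ hc hM hML hWP hWQ hDP hDQ hU hid) hrem hr hβ' hcont hup

/-- **THE BASE-POINT-AVERAGED SLOT-FAMILIES SCALAR WALL** (RULING (R13-3) shape): `SquareTable.oneLoopDrift_of_scalarBounds_avg` with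
ONE KERNEL PER LEG PER SLOT PER BASE POINT — `GP_{n,b} (i,κ)`, `GQ_{n,b} (i,κ)` — each obeying the six graded rows for every
`b ∈ Bset n` with constants free of slot, copy and base point; convex base-point weights `wt n`; ONE comparison per scale of
`composedCoeff μC m` with `Σ_b wt_b·fullSum (stKc …_{Lc^m,b})` ((W3b′)ₛₗ-avg); `IdentityForm`.  SAME conclusion as the one-point wall.
[folklore] -/
theorem oneLoopDrift_of_slotBounds_avg {β : HBeta} (S : B12Beta.OneLoopSplit β) (hμν : μ ≠ ν) {N : ℝ} (hN : N ≠ 0)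
    {Lc : ℕ} (hL : 2 ≤ Lc) {μC : ℕ → ℕ → ℝ} {ω : BfIdx → K → ℝ} (hω : ∀ i, ∑ κ, ω i κ = 1)
    {Bset : ℕ → Finset κB} {wt : ℕ → κB → ℝ} {GP GQ : ℕ → κB → BfIdx × K → Pt → ℝ} {D A : ℕ → ℝ}
    (hD : ∀ j, 0 ≤ D j) (hA : ∀ j, 0 ≤ A j) {δ U cc : ℝ} {M : ℕ → ℕ} (hδ : 0 < δ)
    (hwt0 : ∀ n : ℕ, 2 ≤ n → ∀ b ∈ Bset n, 0 ≤ wt n b) (hwt1 : ∀ n : ℕ, 2 ≤ n → ∑ b ∈ Bset n, wt n b = 1)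
    (hc : 1 ≤ cc) (hM : ∀ L : ℕ, 2 ≤ L → 1 ≤ M L ∧ (L : ℝ) ≤ cc * M L) (hML : ∀ L : ℕ, 2 ≤ L → M L ≤ L)
    (hWP : ∀ n : ℕ, 2 ≤ n → ∀ b ∈ Bset n, ∀ p, WindowRows μ ν D n (GP n b p))
    (hWQ : ∀ n : ℕ, 2 ≤ n → ∀ b ∈ Bset n, ∀ p, WindowRows μ ν D n (GQ n b p))
    (hDP : ∀ n : ℕ, 2 ≤ n → ∀ b ∈ Bset n, ∀ p, DecayRows μ ν A δ n (GP n b p))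
    (hDQ : ∀ n : ℕ, 2 ≤ n → ∀ b ∈ Bset n, ∀ p, DecayRows μ ν A δ n (GQ n b p))
    (hU : ∀ m : ℕ, 1 ≤ m →
      |composedCoeff μC m - ∑ b ∈ Bset (Lc ^ m), wt (Lc ^ m) b * fullSum (stKc μ ν N ω (GP (Lc ^ m) b) (GQ (Lc ^ m) b))| ≤ U)
    (hid : IdentityForm μC S.β0) :
    OneLoopDrift (B12Normalization.stepBal N Lc)
      (constA (|kappaBal N| * 24 + |kappaBal N| * 110592) (bubbleConst Finset.univ (cpCoeff N ω) (cpP hμν) (cpQ hμν))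
          ((80 * (∑ p ∈ (Finset.univ : Finset (BfIdx × K)), |cpCoeff N ω p| *
              (A ((bfP hμν p.1).a - 2) * (A ((bfQ hμν p.1).a - 2) * 2 ^ (bfQ hμν p.1).a))) * (1 + cc / δ) + (U + 1)) +
            80 * ∑ p ∈ (Finset.univ : Finset (BfIdx × K)), |cpCoeff N ω p| *
              ((((bfP hμν p.1).A + (bfP hμν p.1).B) * D ((bfQ hμν p.1).a - 2) +
                  D ((bfP hμν p.1).a - 2) * ((bfQ hμν p.1).A + (bfQ hμν p.1).B) +
                D ((bfP hμν p.1).a - 2) * D ((bfQ hμν p.1).a - 2))))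
          cc (kappaBal N * transverseValue)) S.β0 :=
  have hR' : ∀ p ∈ (Finset.univ : Finset (BfIdx × K)), 0 ≤ A ((bfP hμν p.1).a - 2) := fun p _ => hA _
  have hS' : ∀ p ∈ (Finset.univ : Finset (BfIdx × K)), 0 ≤ A ((bfQ hμν p.1).a - 2) * 2 ^ (bfQ hμν p.1).a :=
    fun p _ => mul_nonneg (hA _) (by positivity)
  oneLoopDrift_of_composedLegInterfacePow_identity_avg S (hdeg_cp hμν) hμν hN (hval_cp hμν N hω) hL
    (F' := fun b p n w => stP μ ν (GP n b p) p.1 w) (G' := fun b p n w => stQ μ ν (GQ n b p) p.1 w) hwt0 hwt1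
    (fun _ _ => hD _) (fun _ _ => hD _) hR' hS' hδ hc hM hML (hF_slots_avg hμν hL hML hD hWP) (hG_slots_avg hμν hL hML hD hWQ)
    (hFtail_slots_avg hμν hA hDP hL) (hGtail_slots_avg hμν hA hδ (fun L hL2 => (hM L hL2).1) hDQ hL)
    (hident_of_slotFullSum_avg hμν hL hwt0 hwt1 hR' hS' hδ (hFtail_slots_avg hμν hA hDP hL)
      (hGtail_slots_avg hμν hA hδ (fun L hL2 => (hM L hL2).1) hDQ hL) hU one_pos) hid

/-- **`EndpointExistence` FROM THE BASE-POINT-AVERAGED SLOT-FAMILIES WALL** (`SquareTable.endpointExistence_of_scalarBounds_avg` with slot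
families).  Conditional end statement; NOT the continuum limit, NOT Clay. [folklore] -/
theorem endpointExistence_of_slotBounds_avg {β : HBeta} {Cn : B12.Construction} (hgen : ForwardGenerated Cn β)
    (S : B12Beta.OneLoopSplit β) (hμν : μ ≠ ν) {N : ℝ} (hN : N ≠ 0)
    {Lc : ℕ} (hL : 2 ≤ Lc) {μC : ℕ → ℕ → ℝ} {ω : BfIdx → K → ℝ} (hω : ∀ i, ∑ κ, ω i κ = 1)
    {Bset : ℕ → Finset κB} {wt : ℕ → κB → ℝ} {GP GQ : ℕ → κB → BfIdx × K → Pt → ℝ} {D A : ℕ → ℝ}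
    (hD : ∀ j, 0 ≤ D j) (hA : ∀ j, 0 ≤ A j) {δ U cc : ℝ} {M : ℕ → ℕ} (hδ : 0 < δ)
    (hwt0 : ∀ n : ℕ, 2 ≤ n → ∀ b ∈ Bset n, 0 ≤ wt n b) (hwt1 : ∀ n : ℕ, 2 ≤ n → ∑ b ∈ Bset n, wt n b = 1)
    (hc : 1 ≤ cc) (hM : ∀ L : ℕ, 2 ≤ L → 1 ≤ M L ∧ (L : ℝ) ≤ cc * M L) (hML : ∀ L : ℕ, 2 ≤ L → M L ≤ L)
    (hWP : ∀ n : ℕ, 2 ≤ n → ∀ b ∈ Bset n, ∀ p, WindowRows μ ν D n (GP n b p))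
    (hWQ : ∀ n : ℕ, 2 ≤ n → ∀ b ∈ Bset n, ∀ p, WindowRows μ ν D n (GQ n b p))
    (hDP : ∀ n : ℕ, 2 ≤ n → ∀ b ∈ Bset n, ∀ p, DecayRows μ ν A δ n (GP n b p))
    (hDQ : ∀ n : ℕ, 2 ≤ n → ∀ b ∈ Bset n, ∀ p, DecayRows μ ν A δ n (GQ n b p))
    (hU : ∀ m : ℕ, 1 ≤ m →
      |composedCoeff μC m - ∑ b ∈ Bset (Lc ^ m), wt (Lc ^ m) b * fullSum (stKc μ ν N ω (GP (Lc ^ m) b) (GQ (Lc ^ m) b))| ≤ U)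
    (hid : IdentityForm μC S.β0)
    {rr γ₀ β' : ℝ} (hγ₀ : 0 < γ₀) (hrem : RemainderConst S γ₀ rr) (hr : rr ≤ B12Normalization.stepBal N Lc)
    (hβ' : 0 ≤ β') (hcont : BetaContH γ₀ β) (hup : BetaUpperH β' γ₀ β) : EndpointExistence Cn :=
  endpointExistence_of_drift_remainderConst hgen S hγ₀
    (oneLoopDrift_of_slotBounds_avg S hμν hN hL hω hD hA hδ hwt0 hwt1 hc hM hML hWP hWQ hDP hDQ hU hid) hrem hr hβ' hcont hup

end Walls

/-! ## §7 Consistency: the one-kernel wall is the diagonal, single-copy instance -/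

section Consistency

variable {μ ν : Fin 4} {κB : Type*}

open FlowStep
open Literature.MathematicalPhysics.QuantumFieldTheory.Balaban1983to89.Beta.LargeLWindow.WindowDecomposition (constA)
open Literature.MathematicalPhysics.QuantumFieldTheory.Balaban1983to89.Beta.Drift (OneLoopDrift)
open Literature.MathematicalPhysics.QuantumFieldTheory.Balaban1983to89.Beta.MarginalTelescoping (composedCoeff IdentityForm)
open Literature.MathematicalPhysics.QuantumFieldTheory.Balaban1983to89.Beta.WindowIdentification (fullSum)

/-- slot sums of the trivially-copied table are the realised table's slot sums. [folklore] -/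
theorem sum_cp_unit (N : ℝ) (f : BfIdx → ℝ) :
    ∑ p ∈ (Finset.univ : Finset (BfIdx × Unit)), |cpCoeff N unitCopy p| * f p.1 =
      ∑ i ∈ (Finset.univ : Finset BfIdx), |bfCoeff N i| * f i := by
  simp only [cpCoeff_apply, unitCopy, mul_one]
  rw [← Finset.univ_product_univ, Finset.sum_product]
  simp

/-- the tail slot sum of the trivially-copied table is the realised one (first-order instance of `sum_cp_unit`). [folklore] -/
theorem sumTail_cp_unit (hμν : μ ≠ ν) (N : ℝ) (A : ℕ → ℝ) :
    ∑ p ∈ (Finset.univ : Finset (BfIdx × Unit)), |cpCoeff N unitCopy p| *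
        (A ((bfP hμν p.1).a - 2) * (A ((bfQ hμν p.1).a - 2) * 2 ^ (bfQ hμν p.1).a)) =
      ∑ i ∈ (Finset.univ : Finset BfIdx), |bfCoeff N i| * (A ((bfP hμν i).a - 2) * (A ((bfQ hμν i).a - 2) * 2 ^ (bfQ hμν i).a)) :=
  sum_cp_unit N (fun i => A ((bfP hμν i).a - 2) * (A ((bfQ hμν i).a - 2) * 2 ^ (bfQ hμν i).a))

/-- the window slot sum of the trivially-copied table is the realised one (first-order instance of `sum_cp_unit`). [folklore] -/
theorem sumWindow_cp_unit (hμν : μ ≠ ν) (N : ℝ) (D : ℕ → ℝ) :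
    ∑ p ∈ (Finset.univ : Finset (BfIdx × Unit)), |cpCoeff N unitCopy p| *
        ((((bfP hμν p.1).A + (bfP hμν p.1).B) * D ((bfQ hμν p.1).a - 2) +
            D ((bfP hμν p.1).a - 2) * ((bfQ hμν p.1).A + (bfQ hμν p.1).B) +
          D ((bfP hμν p.1).a - 2) * D ((bfQ hμν p.1).a - 2))) =
      ∑ i ∈ (Finset.univ : Finset BfIdx), |bfCoeff N i| *
        ((((bfP hμν i).A + (bfP hμν i).B) * D ((bfQ hμν i).a - 2) + D ((bfP hμν i).a - 2) * ((bfQ hμν i).A + (bfQ hμν i).B) +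
          D ((bfP hμν i).a - 2) * D ((bfQ hμν i).a - 2))) :=
  sum_cp_unit N (fun i => (((bfP hμν i).A + (bfP hμν i).B) * D ((bfQ hμν i).a - 2) +
    D ((bfP hμν i).a - 2) * ((bfQ hμν i).A + (bfQ hμν i).B) + D ((bfP hμν i).a - 2) * D ((bfQ hμν i).a - 2)))

/-- **NOTHING IS LOST** (an `example`, since its statement IS the landed `SquareTable.oneLoopDrift_of_scalarBounds_avg` — constant
verbatim): the one-kernel wall is the slot-families wall at one copy of weight `1` and the constant slot family `GP = GQ = G_{n,b}`.
[folklore] -/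
example {β : HBeta} (S : B12Beta.OneLoopSplit β) (hμν : μ ≠ ν) {N : ℝ} (hN : N ≠ 0)
    {Lc : ℕ} (hL : 2 ≤ Lc) {μC : ℕ → ℕ → ℝ} {Bset : ℕ → Finset κB} {wt : ℕ → κB → ℝ} {Gf : ℕ → κB → Pt → ℝ} {D A : ℕ → ℝ}
    (hD : ∀ j, 0 ≤ D j) (hA : ∀ j, 0 ≤ A j) {δ U cc : ℝ} {M : ℕ → ℕ} (hδ : 0 < δ)
    (hwt0 : ∀ n : ℕ, 2 ≤ n → ∀ b ∈ Bset n, 0 ≤ wt n b) (hwt1 : ∀ n : ℕ, 2 ≤ n → ∑ b ∈ Bset n, wt n b = 1)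
    (hc : 1 ≤ cc) (hM : ∀ L : ℕ, 2 ≤ L → 1 ≤ M L ∧ (L : ℝ) ≤ cc * M L) (hML : ∀ L : ℕ, 2 ≤ L → M L ≤ L)
    (h0 : ∀ n : ℕ, 2 ≤ n → ∀ b ∈ Bset n, ∀ v, |Gf n b v - gFree v| ≤ D 0 / (n : ℝ) ^ 2)
    (h1 : ∀ n : ℕ, 2 ≤ n → ∀ b ∈ Bset n, ∀ v (ρ : Fin 4),
      |(Gf n b (v + unitVec ρ) - gFree (v + unitVec ρ)) - (Gf n b v - gFree v)| ≤ D 1 / (n : ℝ) ^ 3)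
    (h2 : ∀ n : ℕ, 2 ≤ n → ∀ b ∈ Bset n, ∀ v,
      |(Gf n b (v + unitVec ν + unitVec μ) - gFree (v + unitVec ν + unitVec μ)) - (Gf n b (v + unitVec ν) - gFree (v + unitVec ν)) -
          (Gf n b (v + unitVec μ) - gFree (v + unitVec μ)) + (Gf n b v - gFree v)| ≤ D 2 / (n : ℝ) ^ 4)
    (d0 : ∀ n : ℕ, 2 ≤ n → ∀ b ∈ Bset n, ∀ v : Pt, v ≠ 0 → |Gf n b v| ≤ A 0 * Real.exp (-(δ / n) * supNorm v) / (supNorm v : ℝ) ^ 2)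
    (d1 : ∀ n : ℕ, 2 ≤ n → ∀ b ∈ Bset n, ∀ v : Pt, v ≠ 0 → ∀ ρ : Fin 4,
      |Gf n b (v + unitVec ρ) - Gf n b v| ≤ A 1 * Real.exp (-(δ / n) * supNorm v) / (supNorm v : ℝ) ^ 3)
    (d2 : ∀ n : ℕ, 2 ≤ n → ∀ b ∈ Bset n, ∀ v : Pt, v ≠ 0 →
      |Gf n b (v + unitVec ν + unitVec μ) - Gf n b (v + unitVec ν) - Gf n b (v + unitVec μ) + Gf n b v| ≤
        A 2 * Real.exp (-(δ / n) * supNorm v) / (supNorm v : ℝ) ^ 4)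
    (hU : ∀ m : ℕ, 1 ≤ m → |composedCoeff μC m - ∑ b ∈ Bset (Lc ^ m), wt (Lc ^ m) b * fullSum (stK μ ν N (Gf (Lc ^ m) b))| ≤ U)
    (hid : IdentityForm μC S.β0) :
    OneLoopDrift (B12Normalization.stepBal N Lc)
      (constA (|kappaBal N| * 24 + |kappaBal N| * 110592) (bubbleConst Finset.univ (bfCoeff N) (bfP hμν) (bfQ hμν))
          ((80 * (∑ i ∈ (Finset.univ : Finset BfIdx), |bfCoeff N i| *
              (A ((bfP hμν i).a - 2) * (A ((bfQ hμν i).a - 2) * 2 ^ (bfQ hμν i).a))) * (1 + cc / δ) + (U + 1)) +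
            80 * ∑ i ∈ (Finset.univ : Finset BfIdx), |bfCoeff N i| *
              ((((bfP hμν i).A + (bfP hμν i).B) * D ((bfQ hμν i).a - 2) + D ((bfP hμν i).a - 2) * ((bfQ hμν i).A + (bfQ hμν i).B) +
                D ((bfP hμν i).a - 2) * D ((bfQ hμν i).a - 2))))
          cc (kappaBal N * transverseValue)) S.β0 := by
  have hU' : ∀ m : ℕ, 1 ≤ m → |composedCoeff μC m - ∑ b ∈ Bset (Lc ^ m), wt (Lc ^ m) b *
      fullSum (stKc μ ν N unitCopy (fun _ : BfIdx × Unit => Gf (Lc ^ m) b) (fun _ => Gf (Lc ^ m) b))| ≤ U := by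
    intro m hm
    have e : ∀ b, stKc μ ν N unitCopy (fun _ : BfIdx × Unit => Gf (Lc ^ m) b) (fun _ => Gf (Lc ^ m) b) =
        stK μ ν N (Gf (Lc ^ m) b) :=
      fun b => funext fun w => stKc_const N (Gf (Lc ^ m) b) w
    simp_rw [e]
    exact hU m hm
  have h := oneLoopDrift_of_slotBounds_avg S hμν hN hL unitCopy_sum (GP := fun n b _ => Gf n b) (GQ := fun n b _ => Gf n b) hD hA hδ
    hwt0 hwt1 hc hM hML (fun n hn b hb _ => ⟨h0 n hn b hb, h1 n hn b hb, h2 n hn b hb⟩)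
    (fun n hn b hb _ => ⟨h0 n hn b hb, h1 n hn b hb, h2 n hn b hb⟩) (fun n hn b hb _ => ⟨d0 n hn b hb, d1 n hn b hb, d2 n hn b hb⟩)
    (fun n hn b hb _ => ⟨d0 n hn b hb, d1 n hn b hb, d2 n hn b hb⟩) hU' hid
  rw [bubbleConst_cp_unit, sumTail_cp_unit, sumWindow_cp_unit] at h
  exact h

end Consistency

/-! ## §8 Product labels: nonnegative copy splittings fold into the base-point labels -/

section ProductLabels

variable {κB K : Type*}

/-- **CONVEX × CONVEX = CONVEX ON THE PRODUCT**: base-point weights `wt` on `B` times NONNEGATIVE copy weights `ω` on `C` are convex weights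
on `B ×ˢ C` — so a nonnegative copy splitting may be folded into the labels of the per-base-point sockets (`SquareTable` §15 or §6 above)
instead of the signed copy structure of §2. [folklore] -/
theorem convexWeights_product {B : Finset κB} {C : Finset K} {wt : κB → ℝ} {ω : K → ℝ}
    (hwt0 : ∀ b ∈ B, 0 ≤ wt b) (hwt1 : ∑ b ∈ B, wt b = 1) (hω0 : ∀ κ ∈ C, 0 ≤ ω κ) (hω1 : ∑ κ ∈ C, ω κ = 1) :
    (∀ q ∈ B ×ˢ C, 0 ≤ wt q.1 * ω q.2) ∧ ∑ q ∈ B ×ˢ C, wt q.1 * ω q.2 = 1 := by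
  refine ⟨fun q hq => ?_, ?_⟩
  · rw [Finset.mem_product] at hq
    exact mul_nonneg (hwt0 _ hq.1) (hω0 _ hq.2)
  · rw [Finset.sum_product]
    have : ∀ b ∈ B, ∑ κ ∈ C, wt b * ω κ = wt b := fun b _ => by rw [← Finset.mul_sum, hω1, mul_one]
    rw [Finset.sum_congr rfl this, hwt1]

end ProductLabels

/-! ## Examples -/

section Examples

/-- the signed sector weights `(½,½,½,½,−1)` of the `cellForm`-shaped slots (four vector copies at loop weight `−½` against one ghost at
`+1`, net `−1`) sum to `1`: admissible copy weights of §2. [folklore] -/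
example : ∑ κ : Fin 5, (![1/2, 1/2, 1/2, 1/2, -1] : Fin 5 → ℝ) κ = 1 := by
  simp [Fin.sum_univ_five]; norm_num

/-- the copy-enlarged table over two copies with weights `(t, 1−t)` on every slot has Bałaban's `hval`. [folklore] -/
example {μ ν : Fin 4} (hμν : μ ≠ ν) (N t : ℝ) (x : E4) (hx : x ≠ 0) :
    x μ * x ν * contBubble Finset.univ (cpCoeff N (fun _ : BfIdx => (![t, 1 - t] : Fin 2 → ℝ))) (cpP hμν) (cpQ hμν) x =
      leadingIntegrand (kappaBal N) μ ν x :=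
  hval_cp hμν N (fun _ => by simp [Fin.sum_univ_two]) x hx

/-- one kernel for all legs, one copy: the slot kernel is `SquareTable.stK` (hence `8N²·D_{μν}(G²) − 4N²·cellForm G`,
`SquareTable.stK_eq_closedForm`). [folklore] -/
example {μ ν : Fin 4} (N : ℝ) (G : Pt → ℝ) (w : Pt) :
    stKc μ ν N unitCopy (fun _ : BfIdx × Unit => G) (fun _ => G) w =
      toReal w μ * toReal w ν * (8 * N ^ 2 * mixedDiffFun (fun u => G u ^ 2) (unitVec μ) (unitVec ν) w -
        4 * N ^ 2 * cellForm G (unitVec μ) (unitVec ν) w) := by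
  rw [stKc_const, stK_eq_closedForm]

end Examples

end Literature.MathematicalPhysics.QuantumFieldTheory.Balaban1983to89.Beta.SquareTableSlots
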